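import Literature.Probability.Entropy.FiniteShannonIndependence
import Mathlib.Algebra.Module.ZMod
import Mathlib.Analysis.Convex.StdSimplex
import HarnessLib

/-!
# The entropic Ruzsa calculus in elementary abelian 2-groups (Gowers–Green–Manners–Tao)

Topic `Literature/Combinatorics/Additive`. Everything in this file is PROVED. It is the first of
the files formalising W. T. Gowers, B. Green, F. Manners, T. Tao, *On a conjecture of Marton*,
Ann. of Math. (2) 201 (2025), no. 2 (GGMT) — the polynomial Freiman–Ruzsa theorem over `𝔽₂ⁿ`
(`Literature.Combinatorics.Additive.polynomialFreimanRuzsa`, discharged in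
`PolynomialFreimanRuzsaProofs`). Random variables are maps on finite weighted sets `(s, w)` as in
`Literature.Probability.Entropy.FiniteShannon` / `FiniteShannonIndependence`; the group `G` is an
elementary abelian `2`-group (`[Module (ZMod 2) G]`), which is all that GGMT's characteristic-two
argument needs (`x - y = x + y`, GGMT Remark 4.3), so every sum/difference is written as a sum.

## Content (all in `namespace Literature.Combinatorics.Additive.EntropicRuzsa`)

* characteristic two: `add_self_char2`, `neg_char2`, `sub_char2`, `add_add_cancel_char2`, …
  (linear identities in `G` are then closed by `linear_combination (norm := abel) …`, adding
  terms `add_self_char2 x` to fix parities);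
* laws on `G` as functions `G → ℝ`: `entFun` (`H(μ) = ∑ φ(μ x)`), `subLaw μ ν` (the law of
  `X - Y` for independent `X ∼ μ`, `Y ∼ ν`), the **entropic Ruzsa distance of laws** `dLaw`
  (GGMT (1.2)), the **`τ` functional** `tauLaw η ρ₁ ρ₂ μ₁ μ₂` of GGMT (2.1) and the predicate
  `IsTauMin` ("`(μ₁, μ₂)` minimises `τ` over all pairs of laws", GGMT §2/(3.8));
* for random variables: `rdist s w X t v Y = d[X ; Y]` (depends only on the laws),
  `condRdist` (`d[X | Z ; Y | W]`, GGMT (A.15)) and `condRdist'` (`d[X ; Y | W]`); the bridges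
  `IndepRV.prob_add`, `IndepRV.rdist_eq` (`d[X;Y] = H[X+Y] - H[X]/2 - H[Y]/2` for independent
  `X, Y`), `rdist_eq_ent_prod` (independent copies on the product space), `rdist_univ_id`,
  `rdist_comm`, `rdist_add_const`, congruence lemmas;
* GGMT Appendix A: (A.10)–(A.13) (`ent_sub_mutualInfo_le_ent_add`, `IndepRV.ent_le_ent_add`,
  `abs_ent_sub_ent_le_two_mul_rdist`, `rdist_nonneg`, `IndepRV.ent_add_sub_ent_le`), the Ruzsa
  triangle inequality ((A.14) `ent_add_add_ent_le`, `rdist_triangle`), the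
  Kaimanovich–Vershik–Madiman inequality (Lemma A.1, `kaimanovich_vershik`), the alternative
  formulas for conditional distances ((A.16) `condRdist_eq_of_indep`, `condRdist'_eq_of_indep`);
* GGMT Lemma 5.1 (`condRdist'_le`), Lemma 5.2 (`rdist_add_sub_rdist_le`,
  `condRdist'_add_sub_rdist_le`), Lemma 7.1 (`condRdist'_sub_rdist_le_of_indep₃`), the testing
  of `τ`-minimality (3.9)/(3.10) (`IsTauMin.le_rdist`, `IsTauMin.le_condRdist`), and the
  fibring identity for sums, Corollary 4.2 (`rdist_add_rdist_eq_fibring`).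

The entropic Balog–Szemerédi–Gowers lemma (Lemma A.2), the `100%` inverse theorem (Lemma 2.2),
the existence of `τ`-minimisers, the two estimates, the endgame and Theorem 1.8/1.2 are in the
sibling files `EntropicBSG`, `EntropicRuzsaHundredPercent`, `PolynomialFreimanRuzsaEstimates`,
`PolynomialFreimanRuzsaEndgame`, `PolynomialFreimanRuzsaProofs`.

## References
* W. T. Gowers, B. Green, F. Manners, T. Tao, *On a conjecture of Marton*, Ann. of Math. (2)
  201 (2025), no. 2, 515–549; arXiv:2311.05762 — (1.2), (2.1), §4, §5, §7, Appendix A.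
* T. Tao, *Sumset and inverse sumset theory for Shannon entropy*, CPC 19 (2010) — origin of the
  entropic Ruzsa distance and its triangle inequality.
* The Lean 4 project `teorth/pfr` (Tao et al., 2023) formalised the same paper measure-
  theoretically; the present elementary finite development is independent of it.

## Design choices
* Laws are bare functions `G → ℝ`; "`μ` is a law" is `μ ∈ stdSimplex ℝ G` where needed (the
  reference variables `X₁⁰, X₂⁰` of GGMT are realised as `id` on `(univ, ρ)`), so `τ` is a
  continuous function on the compact `stdSimplex ℝ G × stdSimplex ℝ G`.
* `dLaw` is stated with `subLaw` (the law of `X - Y`) so that it is literally GGMT (1.2); all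
  theorems are for characteristic two, where `subLaw μ ν = subLaw ν μ` is the law of `X + Y`.
* `η` is a real parameter of `tauLaw`/`IsTauMin`; GGMT's value `η = 1/9` is only substituted in
  the final contradiction.
-/

open Finset Real Literature.Probability.Entropy.FiniteShannon

noncomputable section

namespace Literature.Combinatorics.Additive

namespace EntropicRuzsa

variable {G : Type*}

/-! ### Characteristic two -/

section CharTwo

variable [AddCommGroup G] [Module (ZMod 2) G]

/-- In an elementary abelian `2`-group, `x + x = 0`. [folklore] -/
theorem add_self_char2 (x : G) : x + x = 0 := by
  have h : (2 : ZMod 2) • x = 0 := by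
    rw [show (2 : ZMod 2) = 0 from by decide, zero_smul]
  simpa [two_smul] using h

/-- In an elementary abelian `2`-group, `-x = x`. [folklore] -/
theorem neg_char2 (x : G) : -x = x := by
  rw [neg_eq_iff_add_eq_zero, add_self_char2]

/-- In an elementary abelian `2`-group, `x - y = x + y`. [folklore] -/
theorem sub_char2 (x y : G) : x - y = x + y := by
  rw [sub_eq_add_neg, neg_char2]

/-- `x + (x + y) = y`. [folklore] -/
theorem add_add_cancel_char2 (x y : G) : x + (x + y) = y := by
  rw [← add_assoc, add_self_char2, zero_add]

/-- `(x + y) + y = x`. [folklore] -/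
theorem add_add_cancel_right_char2 (x y : G) : x + y + y = x := by
  rw [add_assoc, add_self_char2, add_zero]

/-- `2 • x = 0`. [folklore] -/
theorem two_nsmul_char2 (x : G) : (2 : ℕ) • x = 0 := by rw [two_nsmul, add_self_char2]
/-- `2 • x = 0` (integer scalar). [folklore] -/
theorem two_zsmul_char2 (x : G) : (2 : ℤ) • x = 0 := by rw [two_zsmul, add_self_char2]
/-- `3 • x = x`. [folklore] -/
theorem three_nsmul_char2 (x : G) : (3 : ℕ) • x = x := by
  rw [show (3 : ℕ) = 2 + 1 from rfl, add_nsmul, two_nsmul_char2, one_nsmul, zero_add]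
/-- `3 • x = x` (integer scalar). [folklore] -/
theorem three_zsmul_char2 (x : G) : (3 : ℤ) • x = x := by
  rw [show (3 : ℤ) = 2 + 1 from rfl, add_zsmul, two_zsmul_char2, one_zsmul, zero_add]
/-- `4 • x = 0`. [folklore] -/
theorem four_nsmul_char2 (x : G) : (4 : ℕ) • x = 0 := by
  rw [show (4 : ℕ) = 2 + 2 from rfl, add_nsmul, two_nsmul_char2, zero_add]
/-- `4 • x = 0` (integer scalar). [folklore] -/
theorem four_zsmul_char2 (x : G) : (4 : ℤ) • x = 0 := by
  rw [show (4 : ℤ) = 2 + 2 from rfl, add_zsmul, two_zsmul_char2, zero_add]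

end CharTwo

/-! ### Laws on a finite group: entropy, difference law, Ruzsa distance -/

section EntFun

variable [Fintype G]

/-- The entropy functional `H(μ) = ∑_x φ(μ x)` (`φ(t) = -t log t`) of a function on a finite
group (the Shannon entropy when `μ` is a law). [folklore] -/
def entFun (μ : G → ℝ) : ℝ := ∑ x, negMulLog (μ x)

/-- The entropy functional is invariant under permutations of the group. [folklore] -/
theorem entFun_comp_equiv (μ : G → ℝ) (e : G ≃ G) : entFun (μ ∘ e) = entFun μ :=
  Fintype.sum_equiv e _ _ fun _ => rfl

/-- `H[X] = H(law of X)`. [folklore] -/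
theorem ent_eq_entFun [DecidableEq G] {ι : Type*} (s : Finset ι) (w : ι → ℝ) (X : ι → G) :
    ent s w X = entFun (prob s w X) :=
  ent_eq_sum_univ s w X

/-- The law of a random variable (nonnegative weights, positive mass) lies in the standard
simplex. [folklore] -/
theorem prob_mem_stdSimplex [DecidableEq G] {ι : Type*} {s : Finset ι} {w : ι → ℝ} (hw : ∀ i ∈ s, 0 ≤ w i) (hs : 0 < mass s w)
    (X : ι → G) : prob s w X ∈ stdSimplex ℝ G :=
  ⟨fun a => prob_nonneg hw a, sum_univ_prob_eq_one hs X⟩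

/-- A point of the standard simplex, realised as the identity random variable on `(univ, μ)`,
has nonnegative weights. [folklore] -/
theorem stdSimplex_nonneg {μ : G → ℝ} (hμ : μ ∈ stdSimplex ℝ G) : ∀ x ∈ (univ : Finset G), 0 ≤ μ x :=
  fun x _ => hμ.1 x

/-- A point of the standard simplex has total mass one. [folklore] -/
theorem mass_univ_of_mem_stdSimplex {μ : G → ℝ} (hμ : μ ∈ stdSimplex ℝ G) :
    mass (univ : Finset G) μ = 1 := hμ.2

/-- A point of the standard simplex has positive total mass. [folklore] -/
theorem mass_univ_pos_of_mem_stdSimplex {μ : G → ℝ} (hμ : μ ∈ stdSimplex ℝ G) :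
    0 < mass (univ : Finset G) μ := by
  rw [mass_univ_of_mem_stdSimplex hμ]; exact one_pos

end EntFun

section SubLaw

variable [AddCommGroup G] [Fintype G]

/-- The law of `X - Y` for independent `X ∼ μ`, `Y ∼ ν`:
`P(X - Y = z) = ∑_y μ(z + y) ν(y)`. [folklore] -/
def subLaw (μ ν : G → ℝ) : G → ℝ := fun z => ∑ y, μ (z + y) * ν y

/-- The **entropic Ruzsa distance** between two laws,
`d[μ ; ν] = H[X' - Y'] - H[X']/2 - H[Y']/2` with `X' ∼ μ`, `Y' ∼ ν` independent (GGMT (1.2)).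
[cite: GowersEtAl2025, (1.2)] -/
def dLaw (μ ν : G → ℝ) : ℝ := entFun (subLaw μ ν) - entFun μ / 2 - entFun ν / 2

/-- **The `τ` functional** of GGMT (2.1) on pairs of laws, with parameter `η` (GGMT: `η = 1/9`)
and reference laws `ρ₁, ρ₂`:
`τ[μ₁ ; μ₂] = d[μ₁ ; μ₂] + η d[ρ₁ ; μ₁] + η d[ρ₂ ; μ₂]`. [cite: GowersEtAl2025, (2.1)] -/
def tauLaw (η : ℝ) (ρ₁ ρ₂ μ₁ μ₂ : G → ℝ) : ℝ :=
  dLaw μ₁ μ₂ + η * dLaw ρ₁ μ₁ + η * dLaw ρ₂ μ₂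

/-- `(μ₁, μ₂)` **minimises `τ`** over all pairs of laws on `G` (GGMT §2, proof of Thm 1.8; the
standing hypothesis (3.8) of §§5–7). [cite: GowersEtAl2025, §2 and (3.8)] -/
def IsTauMin (η : ℝ) (ρ₁ ρ₂ μ₁ μ₂ : G → ℝ) : Prop :=
  ∀ ν₁ ν₂ : G → ℝ, ν₁ ∈ stdSimplex ℝ G → ν₂ ∈ stdSimplex ℝ G →
    tauLaw η ρ₁ ρ₂ μ₁ μ₂ ≤ tauLaw η ρ₁ ρ₂ ν₁ ν₂

/-- Unfolding `tauLaw`. [folklore] -/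
theorem tauLaw_def (η : ℝ) (ρ₁ ρ₂ μ₁ μ₂ : G → ℝ) :
    tauLaw η ρ₁ ρ₂ μ₁ μ₂ = dLaw μ₁ μ₂ + η * dLaw ρ₁ μ₁ + η * dLaw ρ₂ μ₂ := rfl

variable [Module (ZMod 2) G]

/-- In characteristic two the difference law is symmetric. [folklore] -/
theorem subLaw_comm (μ ν : G → ℝ) : subLaw μ ν = subLaw ν μ := by
  funext z
  unfold subLaw
  rw [← Equiv.sum_comp (Equiv.addLeft z)]
  simp only [Equiv.coe_addLeft, add_add_cancel_char2, mul_comm]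

/-- `d[μ ; ν] = d[ν ; μ]`. [folklore] -/
theorem dLaw_comm (μ ν : G → ℝ) : dLaw μ ν = dLaw ν μ := by
  rw [dLaw, dLaw, subLaw_comm]; ring

end SubLaw

section General

variable [AddCommGroup G] [DecidableEq G] {ι : Type*}

/-! ### Lower bounds for the entropy of a sum; nonnegativity; `|H[X] - H[Y]| ≤ 2 d` -/

/-- `H[X] - I[X : Y] ≤ H[X + Y]` for arbitrary jointly distributed `X, Y` (GGMT (A.10)).
[cite: GowersEtAl2025, (A.10)] -/
theorem ent_sub_mutualInfo_le_ent_add {s : Finset ι} {w : ι → ℝ} (hw : ∀ i ∈ s, 0 ≤ w i)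
    (X Y : ι → G) : ent s w X - mutualInfo s w X Y ≤ ent s w (fun i => X i + Y i) := by
  -- `H[X + Y] ≥ H[X + Y | Y] = H[X | Y] = H[X] - I[X : Y]`
  have h1 : condEnt s w (fun i => X i + Y i) Y = condEnt s w X Y := by
    refine condEnt_eq_of_determines_left hw fun i _ j _ hY => ?_
    rw [hY]
    exact ⟨fun h => add_right_cancel h, fun h => by rw [h]⟩
  have h2 := condEnt_le_ent (X := fun i => X i + Y i) (Y := Y) hw
  rw [mutualInfo_eq_ent_sub_condEnt hw]
  linarith

/-- `H[Y] - I[X : Y] ≤ H[X + Y]` (GGMT (A.10)). [cite: GowersEtAl2025, (A.10)] -/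
theorem ent_sub_mutualInfo_le_ent_add' {s : Finset ι} {w : ι → ℝ} (hw : ∀ i ∈ s, 0 ≤ w i)
    (X Y : ι → G) : ent s w Y - mutualInfo s w X Y ≤ ent s w (fun i => X i + Y i) := by
  have h := ent_sub_mutualInfo_le_ent_add hw Y X
  rw [mutualInfo_comm] at h
  refine h.trans (le_of_eq (ent_congr fun i _ => add_comm _ _))

/-- For independent `X, Y`: `H[X] ≤ H[X + Y]` (GGMT (A.11)). [cite: GowersEtAl2025, (A.11)] -/
theorem _root_.Literature.Probability.Entropy.FiniteShannon.IndepRV.ent_le_ent_add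
    {s : Finset ι} {w : ι → ℝ} {X Y : ι → G} (hw : ∀ i ∈ s, 0 ≤ w i) (hs : 0 < mass s w)
    (h : IndepRV s w X Y) : ent s w X ≤ ent s w (fun i => X i + Y i) := by
  have h1 := ent_sub_mutualInfo_le_ent_add hw X Y
  rw [h.mutualInfo_eq_zero hs] at h1
  linarith

/-- For independent `X, Y`: `H[Y] ≤ H[X + Y]` (GGMT (A.11)). [cite: GowersEtAl2025, (A.11)] -/
theorem _root_.Literature.Probability.Entropy.FiniteShannon.IndepRV.ent_le_ent_add'
    {s : Finset ι} {w : ι → ℝ} {X Y : ι → G} (hw : ∀ i ∈ s, 0 ≤ w i) (hs : 0 < mass s w)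
    (h : IndepRV s w X Y) : ent s w Y ≤ ent s w (fun i => X i + Y i) := by
  have h1 := ent_sub_mutualInfo_le_ent_add' hw X Y
  rw [h.mutualInfo_eq_zero hs] at h1
  linarith

/-- **Kaimanovich–Vershik–Madiman inequality** (GGMT Lemma A.1; valid in any abelian group): for
independent `X, Y, Z`,
`H[X + Y + Z] - H[X + Y] ≤ H[Y + Z] - H[Y]`. [cite: GowersEtAl2025, Lemma A.1] -/
theorem kaimanovich_vershik {s : Finset ι} {w : ι → ℝ} {X Y Z : ι → G} (hw : ∀ i ∈ s, 0 ≤ w i)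
    (hs : 0 < mass s w) (hX : IndepRV s w X (fun i => (Y i, Z i)))
    (hZ : IndepRV s w Z (fun i => (X i, Y i))) (hYZ : IndepRV s w Y Z) :
    ent s w (fun i => X i + Y i + Z i) - ent s w (fun i => X i + Y i) ≤
      ent s w (fun i => Y i + Z i) - ent s w Y := by
  have h0 := condMutualInfo_nonneg (X := X) (Y := Z) (Z := fun i => X i + Y i + Z i) hw
  rw [condMutualInfo_eq hw] at h0
  have e1 : ent s w (fun i => (X i, X i + Y i + Z i)) = ent s w X + ent s w (fun i => Y i + Z i) := by
    have hX' : IndepRV s w X (fun i => Y i + Z i) := hX.comp id (fun p : G × G => p.1 + p.2)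
    rw [← hX'.ent_pair_eq_add hs]
    refine ent_eq_of_determines hw fun i _ j _ => ?_
    simp only [Prod.mk.injEq]
    constructor
    · rintro ⟨h1, h2⟩; exact ⟨h1, by linear_combination (norm := abel) h2 - h1⟩
    · rintro ⟨h1, h2⟩; exact ⟨h1, by linear_combination (norm := abel) h1 + h2⟩
  have e2 : ent s w (fun i => (Z i, X i + Y i + Z i)) = ent s w Z + ent s w (fun i => X i + Y i) := by
    have hZ' : IndepRV s w Z (fun i => X i + Y i) := hZ.comp id (fun p : G × G => p.1 + p.2)
    rw [← hZ'.ent_pair_eq_add hs]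
    refine ent_eq_of_determines hw fun i _ j _ => ?_
    simp only [Prod.mk.injEq]
    constructor
    · rintro ⟨h1, h2⟩; exact ⟨h1, by linear_combination (norm := abel) h2 - h1⟩
    · rintro ⟨h1, h2⟩; exact ⟨h1, by linear_combination (norm := abel) h1 + h2⟩
  have e3 : ent s w (fun i => (X i, Z i, X i + Y i + Z i)) = ent s w X + ent s w Y + ent s w Z := by
    have : ent s w (fun i => (X i, Z i, X i + Y i + Z i)) = ent s w (fun i => (X i, (Y i, Z i))) := by
      refine ent_eq_of_determines hw fun i _ j _ => ?_
      simp only [Prod.mk.injEq]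
      constructor
      · rintro ⟨h1, h2, h3⟩; exact ⟨h1, by linear_combination (norm := abel) h3 - h1 - h2, h2⟩
      · rintro ⟨h1, h2, h3⟩; exact ⟨h1, h3, by rw [h1, h2, h3]⟩
    rw [this, hX.ent_pair_eq_add hs, hYZ.ent_pair_eq_add hs, add_assoc]
  linarith

end General

section CharTwoEnt

variable [AddCommGroup G] [DecidableEq G] [Module (ZMod 2) G] {ι : Type*}

/-! ### The Ruzsa triangle inequality and the Kaimanovich–Vershik–Madiman inequality -/

/-- The entropy form of the Ruzsa triangle inequality (GGMT (A.14), characteristic two): if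
`Y` is independent of the pair `(X, Z)` then `H[X + Z] + H[Y] ≤ H[X + Y] + H[Y + Z]`.
[cite: GowersEtAl2025, (A.14)] -/
theorem ent_add_add_ent_le {s : Finset ι} {w : ι → ℝ} {X Y Z : ι → G} (hw : ∀ i ∈ s, 0 ≤ w i)
    (hs : 0 < mass s w) (h : IndepRV s w Y (fun i => (X i, Z i))) :
    ent s w (fun i => X i + Z i) + ent s w Y ≤
      ent s w (fun i => X i + Y i) + ent s w (fun i => Y i + Z i) := by
  -- submodularity `H[A, B, C] + H[C] ≤ H[A, C] + H[B, C]` with `A = X+Y`, `B = Z`, `C = X+Z`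
  have hsub := ent_triple_add_ent_le (X := fun i => X i + Y i) (Y := Z) (Z := fun i => X i + Z i) hw
  have e1 : ent s w (fun i => (X i + Y i, Z i, X i + Z i)) = ent s w (fun i => ((X i, Z i), Y i)) := by
    refine ent_eq_of_determines hw fun i _ j _ => ?_
    simp only [Prod.mk.injEq]
    constructor
    · rintro ⟨h1, h2, h3⟩
      have hx : X i = X j := by linear_combination (norm := abel) h3 - h2
      exact ⟨⟨hx, h2⟩, by linear_combination (norm := abel) h1 - hx⟩
    · rintro ⟨⟨h1, h2⟩, h3⟩
      exact ⟨by rw [h1, h3], h2, by rw [h1, h2]⟩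
  have e2 : ent s w (fun i => ((X i, Z i), Y i)) = ent s w (fun i => (X i, Z i)) + ent s w Y :=
    h.symm.ent_pair_eq_add hs
  have e3 : ent s w (fun i => (X i + Y i, X i + Z i)) ≤
      ent s w (fun i => X i + Y i) + ent s w (fun i => Y i + Z i) := by
    have : ent s w (fun i => (X i + Y i, X i + Z i)) = ent s w (fun i => (X i + Y i, Y i + Z i)) := by
      refine ent_eq_of_determines hw fun i _ j _ => ?_
      simp only [Prod.mk.injEq]
      constructor
      · rintro ⟨h1, h2⟩
        exact ⟨h1, by linear_combination (norm := abel) h1 + h2 - add_self_char2 (X i) +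
          add_self_char2 (X j)⟩
      · rintro ⟨h1, h2⟩
        exact ⟨h1, by linear_combination (norm := abel) h1 + h2 - add_self_char2 (Y i) +
          add_self_char2 (Y j)⟩
    rw [this]
    exact ent_pair_le_add hw
  have e4 : ent s w (fun i => (Z i, X i + Z i)) = ent s w (fun i => (X i, Z i)) := by
    refine ent_eq_of_determines hw fun i _ j _ => ?_
    simp only [Prod.mk.injEq]
    constructor
    · rintro ⟨h1, h2⟩; exact ⟨by linear_combination (norm := abel) h2 - h1, h1⟩
    · rintro ⟨h1, h2⟩; exact ⟨h2, by rw [h1, h2]⟩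
  linarith

end CharTwoEnt

section Laws

variable [AddCommGroup G] [Fintype G] [DecidableEq G] {ι κ θ : Type*}

/-- The **entropic Ruzsa distance** `d[X ; Y]` between `G`-valued random variables on two
(possibly different) finite weighted sets: it only depends on the two laws (GGMT (1.2) and the
remark following it). [cite: GowersEtAl2025, (1.2)] -/
def rdist (s : Finset ι) (w : ι → ℝ) (X : ι → G) (t : Finset κ) (v : κ → ℝ) (Y : κ → G) : ℝ :=
  dLaw (prob s w X) (prob t v Y)

/-- The **conditional Ruzsa distance** `d[X | Z ; Y | W] = ∑_{z,w} P(Z = z) P(W = w)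
d[(X | Z = z) ; (Y | W = w)]` (GGMT (A.15)), conditioning being restriction of the index set.
[cite: GowersEtAl2025, (A.15)] -/
def condRdist {γ δ : Type*} [DecidableEq γ] [DecidableEq δ] (s : Finset ι) (w : ι → ℝ) (X : ι → G)
    (Z : ι → γ) (t : Finset κ) (v : κ → ℝ) (Y : κ → G) (W : κ → δ) : ℝ :=
  ∑ z ∈ s.image Z, ∑ w' ∈ t.image W, prob s w Z z * prob t v W w' *
    rdist (s.filter fun i => Z i = z) w X (t.filter fun j => W j = w') v Y

/-- The **semi-conditioned Ruzsa distance** `d[X ; Y | W] = ∑_w P(W = w) d[X ; (Y | W = w)]`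
(GGMT (A.15) with trivial conditioning of `X`). [cite: GowersEtAl2025, (A.15)] -/
def condRdist' {δ : Type*} [DecidableEq δ] (s : Finset ι) (w : ι → ℝ) (X : ι → G)
    (t : Finset κ) (v : κ → ℝ) (Y : κ → G) (W : κ → δ) : ℝ :=
  ∑ w' ∈ t.image W, prob t v W w' * rdist s w X (t.filter fun j => W j = w') v Y

/-- Unfolding `rdist`. [folklore] -/
theorem rdist_def (s : Finset ι) (w : ι → ℝ) (X : ι → G) (t : Finset κ) (v : κ → ℝ) (Y : κ → G) :
    rdist s w X t v Y = dLaw (prob s w X) (prob t v Y) := rfl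

/-- Unfolding `condRdist`. [folklore] -/
theorem condRdist_def {γ δ : Type*} [DecidableEq γ] [DecidableEq δ] (s : Finset ι) (w : ι → ℝ)
    (X : ι → G) (Z : ι → γ) (t : Finset κ) (v : κ → ℝ) (Y : κ → G) (W : κ → δ) :
    condRdist s w X Z t v Y W = ∑ z ∈ s.image Z, ∑ w' ∈ t.image W, prob s w Z z * prob t v W w' *
      rdist (s.filter fun i => Z i = z) w X (t.filter fun j => W j = w') v Y := rfl

/-- Unfolding `condRdist'`. [folklore] -/
theorem condRdist'_def {δ : Type*} [DecidableEq δ] (s : Finset ι) (w : ι → ℝ) (X : ι → G)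
    (t : Finset κ) (v : κ → ℝ) (Y : κ → G) (W : κ → δ) :
    condRdist' s w X t v Y W =
      ∑ w' ∈ t.image W, prob t v W w' * rdist s w X (t.filter fun j => W j = w') v Y := rfl

/-- The Ruzsa distance only depends on the laws. [cite: GowersEtAl2025, §1 (after (1.2))] -/
theorem rdist_eq_of_prob_eq {ι' κ' : Type*} {s : Finset ι} {w : ι → ℝ} {X : ι → G} {t : Finset κ}
    {v : κ → ℝ} {Y : κ → G} {s' : Finset ι'} {w' : ι' → ℝ} {X' : ι' → G} {t' : Finset κ'}
    {v' : κ' → ℝ} {Y' : κ' → G} (hX : ∀ a, prob s w X a = prob s' w' X' a)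
    (hY : ∀ a, prob t v Y a = prob t' v' Y' a) : rdist s w X t v Y = rdist s' w' X' t' v' Y' := by
  rw [rdist_def, rdist_def, funext hX, funext hY]

/-! ### Conditional distances: bookkeeping -/

/-- The Ruzsa distance only depends on the values of the variables on the index sets. [folklore] -/
theorem rdist_congr {s : Finset ι} {w : ι → ℝ} {X X' : ι → G} {t : Finset κ} {v : κ → ℝ}
    {Y Y' : κ → G} (hX : ∀ i ∈ s, X i = X' i) (hY : ∀ j ∈ t, Y j = Y' j) :
    rdist s w X t v Y = rdist s w X' t v Y' :=
  rdist_eq_of_prob_eq (prob_congr hX) (prob_congr hY)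

/-- The semi-conditioned distance only depends on the values of the variables on the index
sets. [folklore] -/
theorem condRdist'_congr {δ : Type*} [DecidableEq δ] {s : Finset ι} {w : ι → ℝ} {X X' : ι → G}
    {t : Finset κ} {v : κ → ℝ} {Y Y' : κ → G} {W W' : κ → δ} (hX : ∀ i ∈ s, X i = X' i)
    (hY : ∀ j ∈ t, Y j = Y' j) (hW : ∀ j ∈ t, W j = W' j) :
    condRdist' s w X t v Y W = condRdist' s w X' t v Y' W' := by
  have hfW : ∀ w', t.filter (fun j => W j = w') = t.filter (fun j => W' j = w') :=
    fun w' => filter_congr fun j hj => by rw [hW j hj]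
  rw [condRdist'_def, condRdist'_def, image_congr hW]
  refine sum_congr rfl fun w' _ => ?_
  rw [prob_congr hW, hfW]
  congr 1
  exact rdist_congr hX fun j hj => hY j (mem_of_mem_filter j hj)

/-- The conditional distance only depends on the values of the variables on the index sets.
[folklore] -/
theorem condRdist_congr {γ δ : Type*} [DecidableEq γ] [DecidableEq δ] {s : Finset ι} {w : ι → ℝ}
    {X X' : ι → G} {Z Z' : ι → γ} {t : Finset κ} {v : κ → ℝ} {Y Y' : κ → G} {W W' : κ → δ}
    (hX : ∀ i ∈ s, X i = X' i) (hZ : ∀ i ∈ s, Z i = Z' i) (hY : ∀ j ∈ t, Y j = Y' j)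
    (hW : ∀ j ∈ t, W j = W' j) :
    condRdist s w X Z t v Y W = condRdist s w X' Z' t v Y' W' := by
  have hfZ : ∀ z, s.filter (fun i => Z i = z) = s.filter (fun i => Z' i = z) :=
    fun z => filter_congr fun i hi => by rw [hZ i hi]
  have hfW : ∀ w', t.filter (fun j => W j = w') = t.filter (fun j => W' j = w') :=
    fun w' => filter_congr fun j hj => by rw [hW j hj]
  rw [condRdist_def, condRdist_def, image_congr hZ, image_congr hW]
  refine sum_congr rfl fun z _ => sum_congr rfl fun w' _ => ?_
  rw [prob_congr hZ, prob_congr hW, hfZ, hfW]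
  congr 1
  exact rdist_congr (fun i hi => hX i (mem_of_mem_filter i hi))
    fun j hj => hY j (mem_of_mem_filter j hj)


/-- The semi-conditioned distance may be computed by summing over any finite set of values
containing the image of the conditioning variable. [folklore] -/
theorem condRdist'_eq_sum {δ : Type*} [DecidableEq δ] (s : Finset ι) (w : ι → ℝ) (X : ι → G)
    (t : Finset κ) (v : κ → ℝ) (Y : κ → G) (W : κ → δ) {T : Finset δ} (hT : t.image W ⊆ T) :
    condRdist' s w X t v Y W = ∑ w' ∈ T, prob t v W w' * rdist s w X (t.filter fun j => W j = w') v Y := by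
  rw [condRdist'_def]
  refine sum_subset hT fun w' _ hw' => ?_
  rw [prob_eq_zero_of_not_mem_image hw', zero_mul]

/-- The conditional distance may be computed by summing over any finite sets of values
containing the images of the conditioning variables. [folklore] -/
theorem condRdist_eq_sum {γ δ : Type*} [DecidableEq γ] [DecidableEq δ] (s : Finset ι) (w : ι → ℝ)
    (X : ι → G) (Z : ι → γ) (t : Finset κ) (v : κ → ℝ) (Y : κ → G) (W : κ → δ) {S : Finset γ}
    {T : Finset δ} (hS : s.image Z ⊆ S) (hT : t.image W ⊆ T) :
    condRdist s w X Z t v Y W = ∑ z ∈ S, ∑ w' ∈ T, prob s w Z z * prob t v W w' *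
      rdist (s.filter fun i => Z i = z) w X (t.filter fun j => W j = w') v Y := by
  rw [condRdist_def]
  have inner : ∀ z, ∑ w' ∈ t.image W, prob s w Z z * prob t v W w' *
      rdist (s.filter fun i => Z i = z) w X (t.filter fun j => W j = w') v Y =
      ∑ w' ∈ T, prob s w Z z * prob t v W w' *
      rdist (s.filter fun i => Z i = z) w X (t.filter fun j => W j = w') v Y := by
    intro z
    refine sum_subset hT fun w' _ hw' => ?_
    rw [prob_eq_zero_of_not_mem_image hw', mul_zero, zero_mul]
  rw [sum_congr rfl fun z _ => inner z]
  refine sum_subset hS fun z _ hz => ?_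
  refine sum_eq_zero fun w' _ => ?_
  rw [prob_eq_zero_of_not_mem_image hz, zero_mul, zero_mul]

/-- The conditional distance as the average of semi-conditioned distances to the fibres:
`d[X | Z ; Y | W] = ∑_z P(Z = z) d[(X | Z = z) ; Y | W]`. [folklore] -/
theorem condRdist_eq_sum_condRdist' {γ δ : Type*} [DecidableEq γ] [DecidableEq δ] (s : Finset ι)
    (w : ι → ℝ) (X : ι → G) (Z : ι → γ) (t : Finset κ) (v : κ → ℝ) (Y : κ → G) (W : κ → δ) :
    condRdist s w X Z t v Y W =
      ∑ z ∈ s.image Z, prob s w Z z * condRdist' (s.filter fun i => Z i = z) w X t v Y W := by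
  rw [condRdist_def]
  refine sum_congr rfl fun z _ => ?_
  rw [condRdist'_def, mul_sum]
  exact sum_congr rfl fun w' _ => by ring

/-- The distance from the identity random variable on `(univ, μ)` is the distance from the
law `μ`. [folklore] -/
theorem rdist_univ_id {μ : G → ℝ} (hμ : μ ∈ stdSimplex ℝ G) (t : Finset κ) (v : κ → ℝ) (Y : κ → G) :
    rdist univ μ id t v Y = dLaw μ (prob t v Y) := by
  rw [rdist_def, funext (prob_univ_id hμ.2)]

/-- **GGMT (3.9)** (`τ`-minimality tested on a pair of random variables): if `(μ₁, μ₂)`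
minimises `τ` and `k = d[μ₁ ; μ₂]`, then for all random variables `X'₁, X'₂` (on any finite
weighted sets) `d[X'₁ ; X'₂] ≥ k - η (d[X₁⁰ ; X'₁] - d[X₁⁰ ; μ₁]) - η (d[X₂⁰ ; X'₂] - d[X₂⁰ ; μ₂])`.
[cite: GowersEtAl2025, (3.9)] -/
theorem IsTauMin.le_rdist {η : ℝ} {ρ₁ ρ₂ μ₁ μ₂ : G → ℝ} (h : IsTauMin η ρ₁ ρ₂ μ₁ μ₂)
    (h₁ : ρ₁ ∈ stdSimplex ℝ G) (h₂ : ρ₂ ∈ stdSimplex ℝ G) {s : Finset ι} {w : ι → ℝ}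
    (X : ι → G) {t : Finset κ} {v : κ → ℝ} (Y : κ → G) (hw : ∀ i ∈ s, 0 ≤ w i)
    (hs : 0 < mass s w) (hv : ∀ j ∈ t, 0 ≤ v j) (ht : 0 < mass t v) :
    dLaw μ₁ μ₂ - η * (rdist univ ρ₁ id s w X - dLaw ρ₁ μ₁) -
      η * (rdist univ ρ₂ id t v Y - dLaw ρ₂ μ₂) ≤ rdist s w X t v Y := by
  have := h _ _ (prob_mem_stdSimplex hw hs X) (prob_mem_stdSimplex hv ht Y)
  rw [tauLaw_def, tauLaw_def] at this
  rw [rdist_univ_id h₁, rdist_univ_id h₂, rdist_def]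
  linarith

/-- **GGMT (3.10)** (the conditioned form of `τ`-minimality):
`d[X'₁ | Y₁ ; X'₂ | Y₂] ≥ k - η (d[X₁⁰ ; X'₁ | Y₁] - d[X₁⁰ ; μ₁]) - η (d[X₂⁰ ; X'₂ | Y₂] - d[X₂⁰ ; μ₂])`.
[cite: GowersEtAl2025, (3.10)] -/
theorem IsTauMin.le_condRdist {γ δ : Type*} [DecidableEq γ] [DecidableEq δ] {η : ℝ}
    {ρ₁ ρ₂ μ₁ μ₂ : G → ℝ} (h : IsTauMin η ρ₁ ρ₂ μ₁ μ₂) (h₁ : ρ₁ ∈ stdSimplex ℝ G)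
    (h₂ : ρ₂ ∈ stdSimplex ℝ G) {s : Finset ι} {w : ι → ℝ} (X : ι → G) (Z : ι → γ)
    {t : Finset κ} {v : κ → ℝ} (Y : κ → G) (W : κ → δ) (hw : ∀ i ∈ s, 0 ≤ w i)
    (hs : 0 < mass s w) (hv : ∀ j ∈ t, 0 ≤ v j) (ht : 0 < mass t v) :
    dLaw μ₁ μ₂ - η * (condRdist' univ ρ₁ id s w X Z - dLaw ρ₁ μ₁) -
      η * (condRdist' univ ρ₂ id t v Y W - dLaw ρ₂ μ₂) ≤ condRdist s w X Z t v Y W := by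
  have hZ1 : ∑ z ∈ s.image Z, prob s w Z z = 1 := sum_prob_eq_one hs subset_rfl
  have hW1 : ∑ w' ∈ t.image W, prob t v W w' = 1 := sum_prob_eq_one ht subset_rfl
  -- every term as a double average over the fibres
  set r₁ : γ → ℝ := fun z => rdist univ ρ₁ id (s.filter fun i => Z i = z) w X with hr₁
  set r₂ : δ → ℝ := fun w' => rdist univ ρ₂ id (t.filter fun j => W j = w') v Y with hr₂
  have hc : ∀ c : ℝ, ∑ z ∈ s.image Z, ∑ w' ∈ t.image W, prob s w Z z * prob t v W w' * c = c := by
    intro c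
    simp_rw [mul_assoc]
    rw [← sum_mul_sum, ← sum_mul, hZ1, hW1]
    ring
  have h1' : condRdist' univ ρ₁ id s w X Z = ∑ z ∈ s.image Z, ∑ w' ∈ t.image W,
      prob s w Z z * prob t v W w' * r₁ z := by
    rw [condRdist'_def]
    refine sum_congr rfl fun z _ => ?_
    simp_rw [mul_assoc, ← mul_sum, ← sum_mul, hW1, one_mul]
    rfl
  have h2' : condRdist' univ ρ₂ id t v Y W = ∑ z ∈ s.image Z, ∑ w' ∈ t.image W,
      prob s w Z z * prob t v W w' * r₂ w' := by
    rw [condRdist'_def]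
    simp_rw [mul_assoc, ← mul_sum, ← sum_mul, hZ1, one_mul]
    rfl
  have eL : dLaw μ₁ μ₂ - η * (condRdist' univ ρ₁ id s w X Z - dLaw ρ₁ μ₁) -
      η * (condRdist' univ ρ₂ id t v Y W - dLaw ρ₂ μ₂) =
      ∑ z ∈ s.image Z, ∑ w' ∈ t.image W, prob s w Z z * prob t v W w' *
        (dLaw μ₁ μ₂ - η * (r₁ z - dLaw ρ₁ μ₁) - η * (r₂ w' - dLaw ρ₂ μ₂)) := by
    have hterm : ∀ z w', prob s w Z z * prob t v W w' *
        (dLaw μ₁ μ₂ - η * (r₁ z - dLaw ρ₁ μ₁) - η * (r₂ w' - dLaw ρ₂ μ₂)) =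
        prob s w Z z * prob t v W w' * dLaw μ₁ μ₂ - η * (prob s w Z z * prob t v W w' * r₁ z) +
        η * (prob s w Z z * prob t v W w' * dLaw ρ₁ μ₁) -
        η * (prob s w Z z * prob t v W w' * r₂ w') +
        η * (prob s w Z z * prob t v W w' * dLaw ρ₂ μ₂) := fun z w' => by ring
    simp only [hterm, sum_add_distrib, sum_sub_distrib]
    simp only [← mul_sum]
    rw [h1', h2', hc, hc, hc]
    ring
  rw [eL, condRdist_def]
  refine sum_le_sum fun z _ => sum_le_sum fun w' _ => ?_
  rcases (prob_nonneg hw z : 0 ≤ prob s w Z z).eq_or_lt with hz | hz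
  · rw [← hz]; simp
  rcases (prob_nonneg hv w' : 0 ≤ prob t v W w').eq_or_lt with hw' | hw'
  · rw [← hw']; simp
  refine mul_le_mul_of_nonneg_left ?_ (mul_nonneg hz.le hw'.le)
  exact h.le_rdist h₁ h₂ X Y (fun i hi => hw i (mem_of_mem_filter i hi))
    (mass_fiber_pos_of_prob_pos hw hz) (fun j hj => hv j (mem_of_mem_filter j hj))
    (mass_fiber_pos_of_prob_pos hv hw')

variable [Module (ZMod 2) G]

/-- `d[X ; Y] = d[Y ; X]`. [folklore] -/
theorem rdist_comm (s : Finset ι) (w : ι → ℝ) (X : ι → G) (t : Finset κ) (v : κ → ℝ) (Y : κ → G) :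
    rdist s w X t v Y = rdist t v Y s w X :=
  dLaw_comm _ _

/-- `d[X | Z ; Y | W] = d[Y | W ; X | Z]`. [folklore] -/
theorem condRdist_comm {γ δ : Type*} [DecidableEq γ] [DecidableEq δ] (s : Finset ι) (w : ι → ℝ)
    (X : ι → G) (Z : ι → γ) (t : Finset κ) (v : κ → ℝ) (Y : κ → G) (W : κ → δ) :
    condRdist s w X Z t v Y W = condRdist t v Y W s w X Z := by
  rw [condRdist_def, condRdist_def, sum_comm]
  refine sum_congr rfl fun w' _ => sum_congr rfl fun z _ => ?_
  rw [rdist_comm]; ring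

/-- **Law of the sum of independent random variables** (characteristic two: `X + Y = X - Y`):
`P(X + Y = z) = ∑_y P(X = z + y) P(Y = y)`. [folklore] -/
theorem _root_.Literature.Probability.Entropy.FiniteShannon.IndepRV.prob_add {s : Finset ι} {w : ι → ℝ} {X Y : ι → G} (h : IndepRV s w X Y) (z : G) :
    prob s w (fun i => X i + Y i) z = subLaw (prob s w X) (prob s w Y) z := by
  have hcomp : (fun i => X i + Y i) = (fun p : G × G => p.1 + p.2) ∘ fun i => (X i, Y i) := rfl
  rw [hcomp, prob_comp_eq_sum (fun p : G × G => p.1 + p.2) (subset_univ _) z, sum_filter,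
    Fintype.sum_prod_type, sum_comm]
  unfold subLaw
  refine Fintype.sum_congr _ _ fun y => ?_
  have : ∀ x : G, (x + y = z ↔ x = z + y) := fun x =>
    ⟨fun h => by rw [← h, add_add_cancel_right_char2], fun h => by rw [h, add_add_cancel_right_char2]⟩
  simp_rw [this, Finset.sum_ite_eq' univ (z + y), if_pos (mem_univ _), h (z + y) y]

/-- **Ruzsa distance of independent variables on one space**:
`d[X ; Y] = H[X + Y] - H[X]/2 - H[Y]/2` (GGMT (1.2), characteristic two).
[cite: GowersEtAl2025, (1.2)] -/
theorem _root_.Literature.Probability.Entropy.FiniteShannon.IndepRV.rdist_eq {s : Finset ι} {w : ι → ℝ} {X Y : ι → G} (h : IndepRV s w X Y) :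
    rdist s w X s w Y = ent s w (fun i => X i + Y i) - ent s w X / 2 - ent s w Y / 2 := by
  rw [rdist_def, dLaw, ent_eq_entFun, ent_eq_entFun, ent_eq_entFun, funext h.prob_add]

/-- **Ruzsa distance via the product space**: for `X` on `(s, w)` and `Y` on `(t, v)`,
`d[X ; Y] = H[X' + Y'] - H[X]/2 - H[Y]/2` with `X', Y'` the independent copies on
`(s × t, w ⊗ v)`. [cite: GowersEtAl2025, (1.2)] -/
theorem rdist_eq_ent_prod {s : Finset ι} {w : ι → ℝ} (X : ι → G) {t : Finset κ} {v : κ → ℝ}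
    (Y : κ → G) (hs : 0 < mass s w) (ht : 0 < mass t v) :
    rdist s w X t v Y = ent (s ×ˢ t) (prodW w v) (fun p => X p.1 + Y p.2) -
      ent s w X / 2 - ent t v Y / 2 := by
  have h := (indepRV_prod (s := s) (w := w) (t := t) (v := v) X Y).rdist_eq
  rw [ent_prod_fst X ht, ent_prod_snd Y hs] at h
  rw [← h]
  exact rdist_eq_of_prob_eq (fun a => (prob_prod_fst X ht.ne' a).symm)
    fun b => (prob_prod_snd Y hs.ne' b).symm

/-- Translating the second variable does not change the Ruzsa distance. [folklore] -/
theorem rdist_add_const {s : Finset ι} {w : ι → ℝ} (X : ι → G) {t : Finset κ} {v : κ → ℝ}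
    (Y : κ → G) (c : G) : rdist s w X t v (fun j => Y j + c) = rdist s w X t v Y := by
  rw [rdist_def, rdist_def, dLaw, dLaw]
  have hY : prob t v (fun j => Y j + c) = prob t v Y ∘ (Equiv.addRight c) := by
    funext b
    simp only [Function.comp_apply, Equiv.coe_addRight]
    have : (fun j => Y j + c) = (Equiv.addRight c) ∘ Y := rfl
    rw [this, show b = Equiv.addRight c (b + c) by simp [add_add_cancel_right_char2],
      prob_comp_of_injective (Equiv.addRight c).injective]
    simp [add_add_cancel_right_char2]
  have hsub : subLaw (prob s w X) (prob t v (fun j => Y j + c)) =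
      subLaw (prob s w X) (prob t v Y) ∘ Equiv.addRight c := by
    funext z
    rw [hY]
    unfold subLaw
    simp only [Function.comp_apply, Equiv.coe_addRight]
    rw [← Equiv.sum_comp (Equiv.addRight c)]
    simp only [Equiv.coe_addRight, add_add_cancel_right_char2]
    refine Fintype.sum_congr _ _ fun y => ?_
    congr 2
    abel
  rw [hsub, hY, entFun_comp_equiv, entFun_comp_equiv]

/-! ### `|H[X] - H[Y]| ≤ 2 d`, nonnegativity, triangle inequality for `rdist` -/

/-- **`|H[X] - H[Y]| ≤ 2 d[X ; Y]`** (GGMT (A.12)), for random variables on arbitrary finite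
weighted sets. [cite: GowersEtAl2025, (A.12)] -/
theorem abs_ent_sub_ent_le_two_mul_rdist {s : Finset ι} {w : ι → ℝ} (X : ι → G) {t : Finset κ}
    {v : κ → ℝ} (Y : κ → G) (hw : ∀ i ∈ s, 0 ≤ w i) (hs : 0 < mass s w) (hv : ∀ j ∈ t, 0 ≤ v j)
    (ht : 0 < mass t v) : |ent s w X - ent t v Y| ≤ 2 * rdist s w X t v Y := by
  rw [rdist_eq_ent_prod X Y hs ht]
  have hP := prodW_nonneg hw hv
  have hm := mass_prod_pos hs ht
  have hind := indepRV_prod (s := s) (w := w) (t := t) (v := v) X Y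
  have h1 := hind.ent_le_ent_add hP hm
  have h2 := hind.ent_le_ent_add' hP hm
  rw [ent_prod_fst X ht] at h1
  rw [ent_prod_snd Y hs] at h2
  rw [abs_le]
  constructor <;> linarith

/-- **`d[X ; Y] ≥ 0`** (GGMT App. A). [cite: GowersEtAl2025, Appendix A] -/
theorem rdist_nonneg {s : Finset ι} {w : ι → ℝ} (X : ι → G) {t : Finset κ}
    {v : κ → ℝ} (Y : κ → G) (hw : ∀ i ∈ s, 0 ≤ w i) (hs : 0 < mass s w) (hv : ∀ j ∈ t, 0 ≤ v j)
    (ht : 0 < mass t v) : 0 ≤ rdist s w X t v Y := by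
  have := abs_ent_sub_ent_le_two_mul_rdist X Y hw hs hv ht
  linarith [abs_nonneg (ent s w X - ent t v Y)]

/-- `H[X + Y] - H[X] ≤ 2 d[X ; Y]` for independent `X, Y` (GGMT (A.13)).
[cite: GowersEtAl2025, (A.13)] -/
theorem _root_.Literature.Probability.Entropy.FiniteShannon.IndepRV.ent_add_sub_ent_le
    {s : Finset ι} {w : ι → ℝ} {X Y : ι → G} (hw : ∀ i ∈ s, 0 ≤ w i) (hs : 0 < mass s w)
    (h : IndepRV s w X Y) :
    ent s w (fun i => X i + Y i) - ent s w X ≤ 2 * rdist s w X s w Y := by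
  rw [h.rdist_eq]
  linarith [h.ent_le_ent_add' hw hs]

/-- **The Ruzsa triangle inequality** `d[X ; Z] ≤ d[X ; Y] + d[Y ; Z]` for random variables on
arbitrary finite weighted sets (GGMT App. A; Ruzsa, Tao). [cite: GowersEtAl2025, Appendix A (Ruzsa triangle inequality)] -/
theorem rdist_triangle {s : Finset ι} {w : ι → ℝ} (X : ι → G) {t : Finset κ} {v : κ → ℝ}
    (Y : κ → G) {u : Finset θ} {r : θ → ℝ} (Z : θ → G) (hw : ∀ i ∈ s, 0 ≤ w i)
    (hs : 0 < mass s w) (hv : ∀ j ∈ t, 0 ≤ v j) (ht : 0 < mass t v) (hr : ∀ k ∈ u, 0 ≤ r k)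
    (hu : 0 < mass u r) : rdist s w X u r Z ≤ rdist s w X t v Y + rdist t v Y u r Z := by
  -- three independent copies on `Ω = (s × u) × t`
  set P := prodW (prodW w r) v with hP
  have hsu : 0 < mass (s ×ˢ u) (prodW w r) := mass_prod_pos hs hu
  have hwP : ∀ p ∈ (s ×ˢ u) ×ˢ t, 0 ≤ P p := prodW_nonneg (prodW_nonneg hw hr) hv
  have hmP : 0 < mass ((s ×ˢ u) ×ˢ t) P := mass_prod_pos hsu ht
  -- laws / entropies of the copies
  have hXlaw : ∀ a, prob ((s ×ˢ u) ×ˢ t) P (fun p => X p.1.1) a = prob s w X a := fun a => by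
    rw [hP, prob_prod_fst (fun q : ι × θ => X q.1) ht.ne', prob_prod_fst X hu.ne']
  have hZlaw : ∀ a, prob ((s ×ˢ u) ×ˢ t) P (fun p => Z p.1.2) a = prob u r Z a := fun a => by
    rw [hP, prob_prod_fst (fun q : ι × θ => Z q.2) ht.ne', prob_prod_snd Z hs.ne']
  have hYlaw : ∀ a, prob ((s ×ˢ u) ×ˢ t) P (fun p => Y p.2) a = prob t v Y a := fun a => by
    rw [hP, prob_prod_snd Y hsu.ne']
  have hXe : ent ((s ×ˢ u) ×ˢ t) P (fun p => X p.1.1) = ent s w X := ent_eq_of_prob_eq hXlaw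
  have hZe : ent ((s ×ˢ u) ×ˢ t) P (fun p => Z p.1.2) = ent u r Z := ent_eq_of_prob_eq hZlaw
  have hYe : ent ((s ×ˢ u) ×ˢ t) P (fun p => Y p.2) = ent t v Y := ent_eq_of_prob_eq hYlaw
  -- independence
  have hY_XZ : IndepRV ((s ×ˢ u) ×ˢ t) P (fun p => Y p.2) (fun p => (X p.1.1, Z p.1.2)) :=
    (indepRV_prod (s := s ×ˢ u) (w := prodW w r) (t := t) (v := v) (fun q => (X q.1, Z q.2)) Y).symm
  have hXY : IndepRV ((s ×ˢ u) ×ˢ t) P (fun p => X p.1.1) (fun p => Y p.2) :=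
    indepRV_prod (s := s ×ˢ u) (w := prodW w r) (t := t) (v := v) (fun q => X q.1) Y
  have hYZ : IndepRV ((s ×ˢ u) ×ˢ t) P (fun p => Y p.2) (fun p => Z p.1.2) :=
    (indepRV_prod (s := s ×ˢ u) (w := prodW w r) (t := t) (v := v) (fun q => Z q.2) Y).symm
  have hXZ : IndepRV ((s ×ˢ u) ×ˢ t) P (fun p => X p.1.1) (fun p => Z p.1.2) :=
    (indepRV_prod (s := s) (w := w) (t := u) (v := r) X Z).prod_fst ht.ne'
  -- the three distances as entropies on `Ω`
  have dXZ : rdist s w X u r Z = ent ((s ×ˢ u) ×ˢ t) P (fun p => X p.1.1 + Z p.1.2) -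
      ent s w X / 2 - ent u r Z / 2 := by
    rw [← rdist_eq_of_prob_eq hXlaw hZlaw, hXZ.rdist_eq, hXe, hZe]
  have dXY : rdist s w X t v Y = ent ((s ×ˢ u) ×ˢ t) P (fun p => X p.1.1 + Y p.2) -
      ent s w X / 2 - ent t v Y / 2 := by
    rw [← rdist_eq_of_prob_eq hXlaw hYlaw, hXY.rdist_eq, hXe, hYe]
  have dYZ : rdist t v Y u r Z = ent ((s ×ˢ u) ×ˢ t) P (fun p => Y p.2 + Z p.1.2) -
      ent t v Y / 2 - ent u r Z / 2 := by
    rw [← rdist_eq_of_prob_eq hYlaw hZlaw, hYZ.rdist_eq, hYe, hZe]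
  have key := ent_add_add_ent_le hwP hmP hY_XZ
  rw [hYe] at key
  linarith

/-! ### Conditional distances: the alternative formulas (GGMT (A.16)) -/

/-- **Alternative formula for the conditional distance** (GGMT (A.16)): if `(X, Z)` and
`(Y, W)` are independent on one finite weighted set, then
`d[X | Z ; Y | W] = H[X + Y | Z, W] - H[X | Z]/2 - H[Y | W]/2`. [cite: GowersEtAl2025, (A.16)] -/
theorem condRdist_eq_of_indep {γ δ : Type*} [DecidableEq γ] [DecidableEq δ] {s : Finset ι}
    {w : ι → ℝ} {X Y : ι → G} {Z : ι → γ} {W : ι → δ} (hw : ∀ i ∈ s, 0 ≤ w i)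
    (h : IndepRV s w (fun i => (X i, Z i)) (fun i => (Y i, W i))) :
    condRdist s w X Z s w Y W = condEnt s w (fun i => X i + Y i) (fun i => (Z i, W i)) -
      condEnt s w X Z / 2 - condEnt s w Y W / 2 := by
  rcases (mass_nonneg hw).eq_or_lt with h0 | hpos
  · -- degenerate case: everything vanishes
    have hZ0 := prob_eq_zero_of_mass_eq_zero h0.symm Z
    have hW0 := prob_eq_zero_of_mass_eq_zero h0.symm W
    have hZW0 := prob_eq_zero_of_mass_eq_zero h0.symm (fun i => (Z i, W i))
    simp [condRdist_def, condEnt_def, hZ0, hW0, hZW0]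
  have hZW : IndepRV s w Z W := h.comp Prod.snd Prod.snd
  have hXZ_W : IndepRV s w (fun i => (X i, Z i)) W := h.comp id Prod.snd
  have hZ_YW : IndepRV s w Z (fun i => (Y i, W i)) := h.comp Prod.snd id
  set F : γ → δ → Finset ι := fun z w' => s.filter fun i => (Z i, W i) = (z, w') with hF
  have hZ1 : ∑ z ∈ s.image Z, prob s w Z z = 1 := sum_prob_eq_one hpos subset_rfl
  have hW1 : ∑ w' ∈ s.image W, prob s w W w' = 1 := sum_prob_eq_one hpos subset_rfl
  -- the three conditional entropies as double sums over `image Z × image W`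
  have e1 : condEnt s w (fun i => X i + Y i) (fun i => (Z i, W i)) =
      ∑ z ∈ s.image Z, ∑ w' ∈ s.image W,
        prob s w Z z * prob s w W w' * ent (F z w') w (fun i => X i + Y i) := by
    rw [condEnt_eq_sum_of_subset (image_pair_subset_product (X := Z) (Y := W)), sum_product]
    refine sum_congr rfl fun z _ => sum_congr rfl fun w' _ => ?_
    rw [hZW z w']
  have e2 : condEnt s w X Z = ∑ z ∈ s.image Z, ∑ w' ∈ s.image W,
      prob s w Z z * prob s w W w' * ent (s.filter fun i => Z i = z) w X := by
    rw [condEnt_def]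
    refine sum_congr rfl fun z _ => ?_
    rw [← sum_mul, ← mul_sum, hW1, mul_one]
  have e3 : condEnt s w Y W = ∑ z ∈ s.image Z, ∑ w' ∈ s.image W,
      prob s w Z z * prob s w W w' * ent (s.filter fun i => W i = w') w Y := by
    rw [condEnt_def]
    simp_rw [mul_assoc, ← mul_sum]
    rw [← sum_mul, hZ1, one_mul]
  -- termwise identity
  have key : ∀ z w', prob s w Z z * prob s w W w' *
      rdist (s.filter fun i => Z i = z) w X (s.filter fun j => W j = w') w Y =
      prob s w Z z * prob s w W w' * ent (F z w') w (fun i => X i + Y i) -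
      prob s w Z z * prob s w W w' * ent (s.filter fun i => Z i = z) w X / 2 -
      prob s w Z z * prob s w W w' * ent (s.filter fun i => W i = w') w Y / 2 := by
    intro z w'
    rcases eq_or_ne (prob s w Z z) 0 with hz | hz
    · simp [hz]
    rcases eq_or_ne (prob s w W w') 0 with hw' | hw'
    · simp [hw']
    have hXlaw : ∀ a, prob (F z w') w X a = prob (s.filter fun i => Z i = z) w X a :=
      fun a => hXZ_W.prob_filter_pair_left hw z hw' a
    have hYlaw : ∀ b, prob (F z w') w Y b = prob (s.filter fun i => W i = w') w Y b :=
      fun b => hZ_YW.prob_filter_pair_right hw hz w' b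
    have hind : IndepRV (F z w') w X Y := h.filter_pair hw z w'
    rw [← rdist_eq_of_prob_eq hXlaw hYlaw, hind.rdist_eq, ent_eq_of_prob_eq hXlaw,
      ent_eq_of_prob_eq hYlaw]
    ring
  rw [condRdist_def, e1, e2, e3, sum_congr rfl fun z _ => sum_congr rfl fun w' _ => key z w']
  simp only [sum_sub_distrib, sum_div]

/-- **Alternative formula for the semi-conditioned distance** (GGMT (A.16)): if `X` is
independent of the pair `(Y, W)`, then `d[X ; Y | W] = H[X + Y | W] - H[X]/2 - H[Y | W]/2`.
[cite: GowersEtAl2025, (A.16)] -/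
theorem condRdist'_eq_of_indep {δ : Type*} [DecidableEq δ] {s : Finset ι} {w : ι → ℝ}
    {X Y : ι → G} {W : ι → δ} (hw : ∀ i ∈ s, 0 ≤ w i) (h : IndepRV s w X (fun i => (Y i, W i))) :
    condRdist' s w X s w Y W =
      condEnt s w (fun i => X i + Y i) W - ent s w X / 2 - condEnt s w Y W / 2 := by
  rcases (mass_nonneg hw).eq_or_lt with h0 | hpos
  · have hW0 := prob_eq_zero_of_mass_eq_zero h0.symm W
    simp [condRdist'_def, condEnt_def, ent_eq_zero_of_mass_eq_zero h0.symm, hW0]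
  have hXW : IndepRV s w X W := h.comp id Prod.snd
  have hW1 : ∑ w' ∈ s.image W, prob s w W w' = 1 := sum_prob_eq_one hpos subset_rfl
  have e0 : ent s w X = ∑ w' ∈ s.image W, prob s w W w' * ent s w X := by
    rw [← sum_mul, hW1, one_mul]
  have key : ∀ w', prob s w W w' * rdist s w X (s.filter fun j => W j = w') w Y =
      prob s w W w' * ent (s.filter fun j => W j = w') w (fun i => X i + Y i) -
      prob s w W w' * ent s w X / 2 -
      prob s w W w' * ent (s.filter fun j => W j = w') w Y / 2 := by
    intro w'
    rcases eq_or_ne (prob s w W w') 0 with hw' | hw'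
    · simp [hw']
    have hXlaw : ∀ a, prob (s.filter fun j => W j = w') w X a = prob s w X a :=
      fun a => hXW.prob_filter_eq hw hw' a
    have hind : IndepRV (s.filter fun j => W j = w') w X Y := h.filter_right hw w'
    rw [← rdist_eq_of_prob_eq hXlaw (fun _ => rfl), hind.rdist_eq, ent_eq_of_prob_eq hXlaw]
    ring
  rw [condRdist'_def, condEnt_def, condEnt_def, e0, sum_congr rfl fun w' _ => key w']
  simp only [sum_sub_distrib, sum_div]

/-! ### GGMT Lemma 5.1, Lemma 5.2 and Lemma 7.1 -/

/-- **GGMT Lemma 5.1** (semi-conditioned form): `d[X ; Y | W] ≤ d[X ; Y] + I[Y : W]/2` for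
`X` and `(Y, W)` on arbitrary finite weighted sets. [cite: GowersEtAl2025, Lemma 5.1] -/
theorem condRdist'_le {δ : Type*} [DecidableEq δ] {s : Finset ι} {w : ι → ℝ} (X : ι → G)
    {t : Finset κ} {v : κ → ℝ} (Y : κ → G) (W : κ → δ) (hw : ∀ i ∈ s, 0 ≤ w i)
    (hs : 0 < mass s w) (hv : ∀ j ∈ t, 0 ≤ v j) (ht : 0 < mass t v) :
    condRdist' s w X t v Y W ≤ rdist s w X t v Y + mutualInfo t v Y W / 2 := by
  set P := prodW w v with hPdef
  have hP : ∀ p ∈ s ×ˢ t, 0 ≤ P p := prodW_nonneg hw hv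
  -- transport of the semi-conditioned distance to the product space
  have e1 : condRdist' s w X t v Y W =
      condRdist' (s ×ˢ t) P (fun p => X p.1) (s ×ˢ t) P (fun p => Y p.2) (fun p => W p.2) := by
    have hsub : (s ×ˢ t).image (fun p => W p.2) ⊆ t.image W := by
      intro a ha
      obtain ⟨p, hp, rfl⟩ := mem_image.1 ha
      exact mem_image_of_mem W (mem_product.1 hp).2
    rw [condRdist'_eq_sum _ _ _ _ _ _ _ hsub, condRdist'_def]
    refine sum_congr rfl fun w' _ => ?_
    rw [hPdef, prob_prod_snd W hs.ne', filter_prod_snd]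
    congr 1
    exact rdist_eq_of_prob_eq (fun a => (prob_prod_fst X ht.ne' a).symm)
      fun b => (prob_prod_snd (s := s) (w := w) (t := t.filter fun j => W j = w') Y hs.ne' b).symm
  have hind : IndepRV (s ×ˢ t) P (fun p => X p.1) (fun p => (Y p.2, W p.2)) :=
    indepRV_prod X (fun j => (Y j, W j))
  rw [e1, condRdist'_eq_of_indep hP hind, rdist_eq_ent_prod X Y hs ht, hPdef, ent_prod_fst X ht,
    condEnt_prod_snd Y W hs, mutualInfo_eq_ent_sub_condEnt hv]
  have h2 := condEnt_le_ent (X := fun p : ι × κ => X p.1 + Y p.2) (Y := fun p => W p.2) hP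
  linarith

/-- **GGMT Lemma 5.2, (5.3)**: for `Y, Z` independent (and `X` arbitrary, on another finite
weighted set), `d[X ; Y + Z] - d[X ; Y] ≤ (H[Y + Z] - H[Y]) / 2`.
[cite: GowersEtAl2025, Lemma 5.2 (5.3)] -/
theorem rdist_add_sub_rdist_le {s : Finset ι} {w : ι → ℝ} (X : ι → G) {t : Finset κ} {v : κ → ℝ}
    {Y Z : κ → G} (h : IndepRV t v Y Z) (hw : ∀ i ∈ s, 0 ≤ w i) (hs : 0 < mass s w)
    (hv : ∀ j ∈ t, 0 ≤ v j) (ht : 0 < mass t v) :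
    rdist s w X t v (fun j => Y j + Z j) - rdist s w X t v Y ≤
      (ent t v (fun j => Y j + Z j) - ent t v Y) / 2 := by
  set P := prodW w v with hPdef
  have hP : ∀ p ∈ s ×ˢ t, 0 ≤ P p := prodW_nonneg hw hv
  have hm : 0 < mass (s ×ˢ t) P := mass_prod_pos hs ht
  have hX : IndepRV (s ×ˢ t) P (fun p => X p.1) (fun p => (Y p.2, Z p.2)) :=
    indepRV_prod X (fun j => (Y j, Z j))
  have hZ : IndepRV (s ×ˢ t) P (fun p => Z p.2) (fun p => (X p.1, Y p.2)) :=
    (h.prod_mixed X hs.ne' ht.ne').symm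
  have hYZ : IndepRV (s ×ˢ t) P (fun p => Y p.2) (fun p => Z p.2) := h.prod_snd hs.ne'
  have kv := kaimanovich_vershik hP hm hX hZ hYZ
  have d1 := rdist_eq_ent_prod (w := w) (v := v) X (fun j => Y j + Z j) hs ht
  have d2 := rdist_eq_ent_prod (w := w) (v := v) X Y hs ht
  have e1 : ent (s ×ˢ t) P (fun p => X p.1 + (Y p.2 + Z p.2)) =
      ent (s ×ˢ t) P (fun p => X p.1 + Y p.2 + Z p.2) :=
    ent_congr fun p _ => (add_assoc _ _ _).symm
  have e2 : ent (s ×ˢ t) P (fun p => Y p.2 + Z p.2) = ent t v (fun j => Y j + Z j) :=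
    ent_prod_snd (fun j => Y j + Z j) hs
  have e3 : ent (s ×ˢ t) P (fun p => Y p.2) = ent t v Y := ent_prod_snd Y hs
  rw [← hPdef] at d1 d2
  rw [d1, d2, e1]
  linarith

/-- **GGMT Lemma 5.2, (5.4)**: for `Y, Z` independent,
`d[X ; Y | Y + Z] - d[X ; Y] ≤ (H[Y + Z] - H[Z]) / 2`. [cite: GowersEtAl2025, Lemma 5.2 (5.4)] -/
theorem condRdist'_add_sub_rdist_le {s : Finset ι} {w : ι → ℝ} (X : ι → G) {t : Finset κ}
    {v : κ → ℝ} {Y Z : κ → G} (h : IndepRV t v Y Z) (hw : ∀ i ∈ s, 0 ≤ w i) (hs : 0 < mass s w)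
    (hv : ∀ j ∈ t, 0 ≤ v j) (ht : 0 < mass t v) :
    condRdist' s w X t v Y (fun j => Y j + Z j) - rdist s w X t v Y ≤
      (ent t v (fun j => Y j + Z j) - ent t v Z) / 2 := by
  have h1 := condRdist'_le X Y (fun j => Y j + Z j) hw hs hv ht
  have h2 : mutualInfo t v Y (fun j => Y j + Z j) = ent t v (fun j => Y j + Z j) - ent t v Z := by
    rw [mutualInfo_def]
    have : ent t v (fun j => (Y j, Y j + Z j)) = ent t v (fun j => (Y j, Z j)) := by
      refine ent_eq_of_determines hv fun i _ j _ => ?_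
      simp only [Prod.mk.injEq]
      constructor
      · rintro ⟨h1, h2⟩; exact ⟨h1, by linear_combination (norm := abel) h2 - h1⟩
      · rintro ⟨h1, h2⟩; exact ⟨h1, by rw [h1, h2]⟩
    rw [this, h.ent_pair_eq_add ht]
    ring
  linarith

/-- **GGMT Lemma 7.1**: for `Y, Z, Z'` independent,
`d[X ; Y + Z | Y + Z + Z'] - d[X ; Y] ≤ (H[Y + Z + Z'] + H[Y + Z] - H[Y] - H[Z']) / 2`.
[cite: GowersEtAl2025, Lemma 7.1] -/
theorem condRdist'_sub_rdist_le_of_indep₃ {s : Finset ι} {w : ι → ℝ} (X : ι → G) {t : Finset κ}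
    {v : κ → ℝ} {Y Z Z' : κ → G} (hYZ : IndepRV t v Y Z)
    (h2 : IndepRV t v (fun j => Y j + Z j) Z') (hw : ∀ i ∈ s, 0 ≤ w i) (hs : 0 < mass s w)
    (hv : ∀ j ∈ t, 0 ≤ v j) (ht : 0 < mass t v) :
    condRdist' s w X t v (fun j => Y j + Z j) (fun j => Y j + Z j + Z' j) - rdist s w X t v Y ≤
      (ent t v (fun j => Y j + Z j + Z' j) + ent t v (fun j => Y j + Z j) - ent t v Y -
        ent t v Z') / 2 := by
  have a := condRdist'_add_sub_rdist_le X h2 hw hs hv ht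
  have b := rdist_add_sub_rdist_le X hYZ hw hs hv ht
  linarith

/-! ### The `τ` functional of GGMT §2 and its minimisers -/

/-! ### The fibring identity for sums (GGMT Corollary 4.2, characteristic two) -/

/-- **GGMT Corollary 4.2** (fibring identity for sums, characteristic two): for independent
`Y₁, Y₂, Y₃, Y₄` on one finite weighted set,
`d[Y₁ + Y₃ ; Y₂ + Y₄] + d[Y₁ | Y₁ + Y₃ ; Y₂ | Y₂ + Y₄] + I[Y₁ + Y₂ : Y₂ + Y₄ | Y₁ + Y₂ + Y₃ + Y₄]
  = d[Y₁ ; Y₂] + d[Y₃ ; Y₄]`.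
The independence of the quadruple is used through the four splittings listed as hypotheses.
[cite: GowersEtAl2025, Corollary 4.2] -/
theorem rdist_add_rdist_eq_fibring {s : Finset ι} {w : ι → ℝ} {Y₁ Y₂ Y₃ Y₄ : ι → G}
    (hw : ∀ i ∈ s, 0 ≤ w i) (hs : 0 < mass s w)
    (h₁₃ : IndepRV s w (fun i => (Y₁ i, Y₃ i)) (fun i => (Y₂ i, Y₄ i)))
    (h₁₂ : IndepRV s w (fun i => (Y₁ i, Y₂ i)) (fun i => (Y₃ i, Y₄ i)))
    (h₁ : IndepRV s w Y₁ Y₃) (h₂ : IndepRV s w Y₂ Y₄) :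
    rdist s w (fun i => Y₁ i + Y₃ i) s w (fun i => Y₂ i + Y₄ i) +
      condRdist s w Y₁ (fun i => Y₁ i + Y₃ i) s w Y₂ (fun i => Y₂ i + Y₄ i) +
      condMutualInfo s w (fun i => Y₁ i + Y₂ i) (fun i => Y₂ i + Y₄ i)
        (fun i => Y₁ i + Y₂ i + Y₃ i + Y₄ i) =
    rdist s w Y₁ s w Y₂ + rdist s w Y₃ s w Y₄ := by
  -- independence facts derived from the four splittings
  have hY₁Y₂ : IndepRV s w Y₁ Y₂ := h₁₃.comp Prod.fst Prod.fst
  have hY₃Y₄ : IndepRV s w Y₃ Y₄ := h₁₃.comp Prod.snd Prod.snd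
  have hS₁₃ : IndepRV s w (fun i => Y₁ i + Y₃ i) (fun i => Y₂ i + Y₄ i) :=
    h₁₃.comp (fun p => p.1 + p.2) (fun p => p.1 + p.2)
  have hS₁₂ : IndepRV s w (fun i => Y₁ i + Y₂ i) (fun i => Y₃ i + Y₄ i) :=
    h₁₂.comp (fun p => p.1 + p.2) (fun p => p.1 + p.2)
  have hfib : IndepRV s w (fun i => (Y₁ i, Y₁ i + Y₃ i)) (fun i => (Y₂ i, Y₂ i + Y₄ i)) :=
    h₁₃.comp (fun p => (p.1, p.1 + p.2)) (fun p => (p.1, p.1 + p.2))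
  -- the five terms in entropy form
  rw [hS₁₃.rdist_eq, hY₁Y₂.rdist_eq, hY₃Y₄.rdist_eq, condRdist_eq_of_indep hw hfib,
    condMutualInfo_eq hw, condEnt_eq_ent_pair_sub hw, condEnt_eq_ent_pair_sub hw,
    condEnt_eq_ent_pair_sub hw]
  -- entropy identities
  have e1 : ent s w (fun i => Y₁ i + Y₃ i + (Y₂ i + Y₄ i)) =
      ent s w (fun i => Y₁ i + Y₂ i + Y₃ i + Y₄ i) := ent_congr fun i _ => by abel
  have e2 : ent s w (fun i => (Y₁ i, Y₁ i + Y₃ i)) = ent s w Y₁ + ent s w Y₃ := by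
    rw [← h₁.ent_pair_eq_add hs]
    refine ent_eq_of_determines hw fun i _ j _ => ?_
    simp only [Prod.mk.injEq]
    constructor
    · rintro ⟨ha, hb⟩; exact ⟨ha, by linear_combination (norm := abel) hb - ha⟩
    · rintro ⟨ha, hb⟩; exact ⟨ha, by rw [ha, hb]⟩
  have e3 : ent s w (fun i => (Y₂ i, Y₂ i + Y₄ i)) = ent s w Y₂ + ent s w Y₄ := by
    rw [← h₂.ent_pair_eq_add hs]
    refine ent_eq_of_determines hw fun i _ j _ => ?_
    simp only [Prod.mk.injEq]
    constructor
    · rintro ⟨ha, hb⟩; exact ⟨ha, by linear_combination (norm := abel) hb - ha⟩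
    · rintro ⟨ha, hb⟩; exact ⟨ha, by rw [ha, hb]⟩
  have e4 : ent s w (fun i => (Y₁ i + Y₃ i, Y₂ i + Y₄ i)) =
      ent s w (fun i => Y₁ i + Y₃ i) + ent s w (fun i => Y₂ i + Y₄ i) := hS₁₃.ent_pair_eq_add hs
  -- `T = H[Y₁+Y₂, Y₁+Y₃, Y₂+Y₄]`
  have e5 : ent s w (fun i => (Y₁ i + Y₂ i, (Y₁ i + Y₃ i, Y₂ i + Y₄ i))) =
      ent s w (fun i => (Y₁ i + Y₂ i, Y₂ i + Y₄ i, Y₁ i + Y₂ i + Y₃ i + Y₄ i)) := by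
    refine ent_eq_of_determines hw fun i _ j _ => ?_
    simp only [Prod.mk.injEq]
    constructor
    · rintro ⟨ha, hb, hc⟩
      exact ⟨ha, hc, by linear_combination (norm := abel) hb + hc⟩
    · rintro ⟨ha, hb, hc⟩
      exact ⟨ha, by linear_combination (norm := abel) hc - hb, hb⟩
  have e6 : ent s w (fun i => (Y₁ i + Y₂ i, Y₁ i + Y₂ i + Y₃ i + Y₄ i)) =
      ent s w (fun i => Y₁ i + Y₂ i) + ent s w (fun i => Y₃ i + Y₄ i) := by
    rw [← hS₁₂.ent_pair_eq_add hs]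
    refine ent_eq_of_determines hw fun i _ j _ => ?_
    simp only [Prod.mk.injEq]
    constructor
    · rintro ⟨ha, hb⟩; exact ⟨ha, by linear_combination (norm := abel) hb - ha⟩
    · rintro ⟨ha, hb⟩; exact ⟨ha, by linear_combination (norm := abel) ha + hb⟩
  have e7 : ent s w (fun i => (Y₂ i + Y₄ i, Y₁ i + Y₂ i + Y₃ i + Y₄ i)) =
      ent s w (fun i => Y₂ i + Y₄ i) + ent s w (fun i => Y₁ i + Y₃ i) := by
    rw [← hS₁₃.symm.ent_pair_eq_add hs]
    refine ent_eq_of_determines hw fun i _ j _ => ?_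
    simp only [Prod.mk.injEq]
    constructor
    · rintro ⟨ha, hb⟩; exact ⟨ha, by linear_combination (norm := abel) hb - ha⟩
    · rintro ⟨ha, hb⟩; exact ⟨ha, by linear_combination (norm := abel) ha + hb⟩
  rw [e1, e2, e3, e4, e5, e6, e7]
  ring

end Laws

end EntropicRuzsa

end Literature.Combinatorics.Additive

end
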